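import Mathlib
import Summits.NavierStokesRegularity.FluidComputer.AbcInertiaCIForm
import Summits.NavierStokesRegularity.FluidComputer.AbcInertiaCIWeight
import Summits.NavierStokesRegularity.FluidComputer.LyapunovInertiaCount

/-!
# INERTIA-3L instantiation — CLASS I twin (instab3 g8; cert-3 g9's `AbcClassI` layer; character-free lemmas
# reused from the class-II files `AbcInertia*`). Part 5: THE COUNT — at most `m` eigenvalues of the class-II operator with
# `Re λ ≥ a`, from the finite certificate facts (R1)(R2)(R3) (instab3 g8, cell `ns-blowup`, 2026-08-27)

HONEST FRAMING (human ruling D-0035): nothing here is a claim about Navier–Stokes blow-up.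
WHAT THIS IS NOT: not NS evidence. MODEL lane: the object is the linearisation of forced Navier–Stokes
about the ABC flow `U = abcFlow 1 1 1` (`f = νU`, `ν = 1/R`, certifier units) restricted to SYMMETRY CLASS II,
in the Cartesian class-II COORDINATES of `AbcClassIIDefs` (instab4 g6): `(L x)_i = −(|O_i|²/R) x_i +
Σ_{j ∈ AbcClassI.nbrIdx i} AbcClassI.amat i j x_j` on `x : AbcClassI.Idx → ℂ` — the operator of `AbcClassIISynthesis.certifier_eigen_of_
coordinates` / `AbcClassIIEigenpair.coords_of_classII_certifier_eigen` (coordinates ⇄ classical eigenpairs).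
No certificate is re-run and no number moves here; the three numerical hypotheses below are exactly what an
INERTIA-3L certificate (`HOME/instab3/PREREG-INERTIA-3L.md`, INSTAB3-METHOD §14; INERTIA-I4 §3, two
code-disjoint implementations) CERTIFIES about finite real matrices.

**`finrank_le_of_inertia_certificate`** (the KERNEL INSTANTIATION of the format theorem
`LyapunovInertiaCount.finrank_le_of_generator_form_neg`, instab3 g7 p493094 — `HOME/instab3/INSTAB3-METHOD.md`
§14.6 (1) = `HOME/instab4/KERNEL-CHAIN.md` K2): let `H = {i : |O_i|² ≤ r_H²}`, `B = {r_H² < |O_i|² ≤ (r_H+1)²}`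
(`L = {|O_i|² ≤ r_L²}`, `r_H ≥ r_L + 1 ≥ 1`, enters only through (R4)), `GH` a real symmetric matrix on `H`
(the HEAD WEIGHT; the certificates use `X ⊕ 1`), `Â = [(−|O_i|²/R − a)δ_ij + AbcClassI.amat i j]_{H×H}`,
`F₂ = GH·amat_{HB} + amat_{BH}ᵀ`, `E_l = |O_l|²/R + a − √2` (`l ∈ B`). IF
  (R1) `x ⬝ ((GH Â + Âᵀ GH + ½ F₂ diag(E)⁻¹ F₂ᵀ) x) < 0` for every real `x ≠ 0` on `H`,
  (R2) `x ⬝ ((GH + V Vᵀ) x) ≥ 0` for every real `x` on `H`, for some real `H × m` matrix `V`,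
  (R3) `√2 < (⌊r_H²⌋ + 1)/R + a`,
THEN every finite-dimensional complex subspace `W` of RAPIDLY DECAYING coordinate vectors
(`Σ_i (1+|O_i|²)^s |x_i|² < ∞` for all `s`) that is invariant under `L` and on which every eigenvalue of `L`
has real part `≥ a` satisfies `finrank ℂ W ≤ m` — i.e. `L` has AT MOST `m` eigenvalues with `Re λ ≥ a`
counted with algebraic multiplicity (Jordan chains of rapidly decaying vectors), and none can be added.

Route: `E = ℓ²(AbcClassI.Idx, ℂ)`; `D = V =` the image of `W`; `A = L − a` on `D`; `G = GH ⊕ 1` (bounded, symmetric: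
`AbcInertiaWeight.exists_weightOp`); `e_μ = V_{·μ} ⊕ 0` (`exists_testVec`); (L⁻) from
`AbcInertiaForm.re_tsum_weighted_form_neg`; the counting hypothesis from (R2)
(`weight_form_nonneg_of_orthogonal`); then p493094. §4: for the certificates' BLOCK weight `GH = X ⊕ 1_{H∖L}`
the coupling matrix `F₂ = GH·amat_{HB} + amat_{BH}ᵀ` has zero `L`-rows and rows `AbcClassI.amat i l + AbcClassI.amat l i` on `H ∖ L`
(`F2_apply_of_blockWeight`, by (R4)) — so (R1) is literally the programs' `𝓜 = (G_H Â_HH + Â_HHᵀ G_H) +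
2·[0_L ⊕ F_AB E_B⁻¹ F_BA]` of PREREG-INERTIA-3L §3 (`F = ½(T + Tᵀ)`, `F₂ = 2F_HB`).

Mathlib + `AbcInertiaForm` + `AbcInertiaWeight` + `LyapunovInertiaCount`; no new definitions; std axioms.
[folklore]
-/

noncomputable section

open scoped BigOperators ComplexConjugate Matrix InnerProductSpace lp
open Finset Matrix

namespace Summit.NavierStokesRegularity.FluidComputer.AbcInertiaCI

open Literature.Analysis.FunctionSpaces Literature.Analysis.FunctionSpaces.Torus
open Literature.Analysis.FluidPDE
open Summit.NavierStokesRegularity.FluidComputer.AbcClassI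
open Summit.NavierStokesRegularity.FluidComputer.AbcClassII (Fam crossForm secOp rotR rotS sgnAct sgnOrbit
  cube extend restrictTo extend_add extend_smul extend_zero rotR_add rotR_smul rotS_add rotS_smul
  crossForm_add crossForm_smul secOp_add secOp_smul restrictTo_add restrictTo_smul Orbit toOrbit onormSq
  osupNorm cubeOrbits nbrOrbits mem_sgnOrbit mem_sgnOrbit_self card_sgnOrbit_le sgnOrbit_eq_of_mem
  mem_sgnOrbit_comm sgnOrbit_eq_or_disjoint neg_mem_sgnOrbit neg_self_mem_sgnOrbit rotFreqR_mem_sgnOrbit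
  rotFreqS_mem_sgnOrbit freqNormSq_eq_of_mem_sgnOrbit supNorm_eq_of_mem_sgnOrbit mem_cube
  mem_cube_iff_supNorm cube_mono sgnOrbit_subset_cube zero_not_mem_sgnOrbit ne_zero_of_mem_sgnOrbit
  toOrbit_val toOrbit_eq_iff mem_cubeOrbits mem_nbrOrbits mem_nbrOrbits_comm card_nbrOrbits_le rotR_apply
  rotS_apply freqNormSq_rotFreq secOp_conj isConjSymm_secOp kdot_secOp mem_iff_of_orbitClosed
  isConjSymm_cut kdot_cut orbitClosed_cube_ne_zero orbitClosed_shell neg_mem_of_orbitClosed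
  isConjSymm_lerayCrossForm kdot_conj conj_eq_zero_of_not_mem linOp_zero_eq conj_theta_neg
  extend_apply_of_mem extend_apply_of_not_mem restrictTo_extend extend_restrictTo extend_sum
  inner_eq_sum_extend inner_conjVec_conjVec conj_sum_inner_of_isConjSymm sum_inner_eq_re_of_isConjSymm
  real_inner_eq_re real_smul_eq norm_lerayCrossForm_le sobolevWeight_one_eq cube_filter_eq_biUnion sum_cube_filter_eq
  onormSq_nonneg)

/-! ### §3 The count -/

section Count

variable {R a rL rH : ℝ} {HL HH HB : Finset AbcClassI.Idx} {m : ℕ}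

/-- **INERTIA-3L ⇒ AT MOST `m` EIGENVALUES WITH `Re λ ≥ a` (class II, coordinates).** See the module
docstring. `W` ranges over finite-dimensional subspaces of rapidly decaying coordinate vectors, invariant
under the coordinate operator `L`, all of whose eigenvalues (within `W`) have real part `≥ a`. -/
theorem finrank_le_of_inertia_certificate (hR : 0 < R) (h0 : 0 ≤ rL) (hLH : rL + 1 ≤ rH)
    (hHL : ∀ i : AbcClassI.Idx, i ∈ HL ↔ onormSq i.1 ≤ rL ^ 2)
    (hHH : ∀ i : AbcClassI.Idx, i ∈ HH ↔ onormSq i.1 ≤ rH ^ 2)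
    (hHB : ∀ i : AbcClassI.Idx, i ∈ HB ↔ rH ^ 2 < onormSq i.1 ∧ onormSq i.1 ≤ (rH + 1) ^ 2)
    (GH Ah : Matrix ↥HH ↥HH ℝ) (AHB : Matrix ↥HH ↥HB ℝ) (ABH : Matrix ↥HB ↥HH ℝ) (E : ↥HB → ℝ)
    (V : Matrix ↥HH (Fin m) ℝ) (hGH : GHᵀ = GH)
    (hAh : Ah = Matrix.of fun i j : ↥HH => (if i = j then -(onormSq i.1.1 / R) - a else 0) + AbcClassI.amat i.1 j.1)
    (hAHB : AHB = Matrix.of fun (i : ↥HH) (l : ↥HB) => AbcClassI.amat i.1 l.1)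
    (hABH : ABH = Matrix.of fun (l : ↥HB) (i : ↥HH) => AbcClassI.amat l.1 i.1)
    (hE : E = fun l : ↥HB => onormSq l.1.1 / R + a - Real.sqrt 2)
    (hR1 : ∀ x : ↥HH → ℝ, x ≠ 0 →
      x ⬝ᵥ ((GH * Ah + Ahᵀ * GH + (1 / 2 : ℝ) • ((GH * AHB + ABHᵀ) * Matrix.diagonal (fun l => (E l)⁻¹) *
        (GH * AHB + ABHᵀ)ᵀ)) *ᵥ x) < 0)
    (hR2 : ∀ x : ↥HH → ℝ, 0 ≤ x ⬝ᵥ ((GH + V * Vᵀ) *ᵥ x))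
    (hR3 : Real.sqrt 2 < ((⌊rH ^ 2⌋₊ : ℝ) + 1) / R + a)
    (W : Submodule ℂ (AbcClassI.Idx → ℂ)) [FiniteDimensional ℂ W]
    (hWs : ∀ x ∈ W, ∀ s : ℕ, Summable fun i : AbcClassI.Idx => (1 + onormSq i.1) ^ s * ‖x i‖ ^ 2)
    (hWinv : ∀ x ∈ W, (fun i : AbcClassI.Idx => ((-(onormSq i.1 / R) : ℝ) : ℂ) * x i +
      ∑ j ∈ AbcClassI.nbrIdx i, ((AbcClassI.amat i j : ℝ) : ℂ) * x j) ∈ W)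
    (hWev : ∀ (μ : ℂ) (x : AbcClassI.Idx → ℂ), x ∈ W → x ≠ 0 →
      (∀ i : AbcClassI.Idx, ((-(onormSq i.1 / R) : ℝ) : ℂ) * x i + ∑ j ∈ AbcClassI.nbrIdx i, ((AbcClassI.amat i j : ℝ) : ℂ) * x j = μ * x i) →
      a ≤ μ.re) :
    Module.finrank ℂ W ≤ m := by
  classical
  have hR3' : ∀ i : AbcClassI.Idx, i ∉ HH → 0 < onormSq i.1 / R + a - Real.sqrt 2 :=
    fun i hi => tailConst_pos_of_not_mem hR hR3 hHH hi
  -- the coordinate operator as a function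
  set Lf : (AbcClassI.Idx → ℂ) → (AbcClassI.Idx → ℂ) := fun x i => ((-(onormSq i.1 / R) : ℝ) : ℂ) * x i +
    ∑ j ∈ AbcClassI.nbrIdx i, ((AbcClassI.amat i j : ℝ) : ℂ) * x j with hLf
  have hLf_add : ∀ x y, Lf (x + y) = Lf x + Lf y := by
    intro x y; funext i
    simp only [hLf, Pi.add_apply, mul_add, Finset.sum_add_distrib]; ring
  have hLf_smul : ∀ (c : ℂ) x, Lf (c • x) = c • Lf x := by
    intro c x; funext i
    simp only [hLf, Pi.smul_apply, smul_eq_mul]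
    rw [mul_add, Finset.mul_sum]
    congr 1
    · ring
    · exact Finset.sum_congr rfl fun j _ => by ring
  have hWinv' : ∀ x ∈ W, Lf x ∈ W := fun x hx => hWinv x hx
  -- the embedding of `W` into ℓ²
  have hmemW : ∀ w : W, Memℓp ((w : AbcClassI.Idx → ℂ)) 2 :=
    fun w => memℓp_two_of_summable_sq (summable_sq_of_rapid (hWs w w.2))
  set ι : W →ₗ[ℂ] ℓ²(AbcClassI.Idx, ℂ) :=
    { toFun := fun w => ⟨(w : AbcClassI.Idx → ℂ), hmemW w⟩
      map_add' := fun w₁ w₂ => by apply lp.ext; rfl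
      map_smul' := fun c w => by apply lp.ext; rfl } with hι
  have hι_apply : ∀ (w : W) (i : AbcClassI.Idx), ι w i = (w : AbcClassI.Idx → ℂ) i := fun w i => rfl
  have hι_inj : Function.Injective ι := by
    intro w₁ w₂ h
    apply Subtype.ext
    funext i
    have := congrArg (fun f : ℓ²(AbcClassI.Idx, ℂ) => f i) h
    simpa [hι_apply] using this
  set D : Submodule ℂ ℓ²(AbcClassI.Idx, ℂ) := LinearMap.range ι with hD
  -- members of `D` are rapidly decaying, and `L − a` maps them into `D`
  have hDmem : ∀ f : ℓ²(AbcClassI.Idx, ℂ), f ∈ D → ∃ w : W, ι w = f := fun f hf => LinearMap.mem_range.mp hf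
  have hAmem : ∀ f : D, Memℓp (fun i : AbcClassI.Idx => Lf (f : ℓ²(AbcClassI.Idx, ℂ)) i - ((a : ℝ) : ℂ) * (f : ℓ²(AbcClassI.Idx, ℂ)) i) 2 := by
    intro f
    obtain ⟨w, hw⟩ := hDmem f f.2
    have hfw : (⇑(f : ℓ²(AbcClassI.Idx, ℂ)) : AbcClassI.Idx → ℂ) = (w : AbcClassI.Idx → ℂ) := by
      funext i; rw [← hw]; rfl
    have hmem : (fun i : AbcClassI.Idx => Lf (f : ℓ²(AbcClassI.Idx, ℂ)) i - ((a : ℝ) : ℂ) * (f : ℓ²(AbcClassI.Idx, ℂ)) i) ∈ W := by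
      rw [hfw]
      have h1 : Lf w ∈ W := hWinv' w w.2
      have h2 : (fun i : AbcClassI.Idx => Lf (w : AbcClassI.Idx → ℂ) i - ((a : ℝ) : ℂ) * (w : AbcClassI.Idx → ℂ) i) =
          Lf w - ((a : ℝ) : ℂ) • (w : AbcClassI.Idx → ℂ) := by funext i; simp
      rw [h2]
      exact W.sub_mem h1 (W.smul_mem _ w.2)
    exact memℓp_two_of_summable_sq (summable_sq_of_rapid (hWs _ hmem))
  set A : D →ₗ[ℂ] ℓ²(AbcClassI.Idx, ℂ) :=
    { toFun := fun f => ⟨fun i : AbcClassI.Idx => Lf (f : ℓ²(AbcClassI.Idx, ℂ)) i - ((a : ℝ) : ℂ) * (f : ℓ²(AbcClassI.Idx, ℂ)) i, hAmem f⟩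
      map_add' := fun f g => by
        apply lp.ext; funext i
        change Lf (⇑((f : ℓ²(AbcClassI.Idx, ℂ)) + (g : ℓ²(AbcClassI.Idx, ℂ)))) i - ((a : ℝ) : ℂ) * ((f : ℓ²(AbcClassI.Idx, ℂ)) + (g : ℓ²(AbcClassI.Idx, ℂ))) i = _
        rw [lp.coeFn_add, hLf_add]
        simp only [Pi.add_apply, AddSubgroup.coe_add]
        change _ = (Lf (f : ℓ²(AbcClassI.Idx, ℂ)) i - ((a : ℝ) : ℂ) * (f : ℓ²(AbcClassI.Idx, ℂ)) i) +
          (Lf (g : ℓ²(AbcClassI.Idx, ℂ)) i - ((a : ℝ) : ℂ) * (g : ℓ²(AbcClassI.Idx, ℂ)) i)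
        ring
      map_smul' := fun c f => by
        apply lp.ext; funext i
        change Lf (⇑(c • (f : ℓ²(AbcClassI.Idx, ℂ)))) i - ((a : ℝ) : ℂ) * (c • (f : ℓ²(AbcClassI.Idx, ℂ))) i = _
        rw [lp.coeFn_smul, hLf_smul]
        simp only [Pi.smul_apply, smul_eq_mul, RingHom.id_apply, lp.coeFn_smul]
        change _ = c * (Lf (f : ℓ²(AbcClassI.Idx, ℂ)) i - ((a : ℝ) : ℂ) * (f : ℓ²(AbcClassI.Idx, ℂ)) i)
        ring } with hA
  have hA_apply : ∀ (f : D) (i : AbcClassI.Idx), A f i = Lf (f : ℓ²(AbcClassI.Idx, ℂ)) i - ((a : ℝ) : ℂ) * (f : ℓ²(AbcClassI.Idx, ℂ)) i :=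
    fun f i => rfl
  -- the weight, the test vectors
  obtain ⟨G, hG, hGsymm⟩ := exists_weightOp (HH := HH) GH hGH
  obtain ⟨e, he⟩ := exists_testVec (HH := HH) V
  -- (L⁻)
  have hL : ∀ f : D, f ≠ 0 → (⟪G (f : ℓ²(AbcClassI.Idx, ℂ)), A f⟫_ℂ).re < 0 := by
    intro f hf0
    obtain ⟨w, hw⟩ := hDmem f f.2
    have hfw : (⇑(f : ℓ²(AbcClassI.Idx, ℂ)) : AbcClassI.Idx → ℂ) = (w : AbcClassI.Idx → ℂ) := by funext i; rw [← hw]; rfl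
    have hrapid : Summable fun i : AbcClassI.Idx => (1 + onormSq i.1) * ‖(f : ℓ²(AbcClassI.Idx, ℂ)) i‖ ^ 2 := by
      rw [hfw]; exact summable_weight_of_rapid (hWs w w.2)
    have hne : (⇑(f : ℓ²(AbcClassI.Idx, ℂ)) : AbcClassI.Idx → ℂ) ≠ 0 := by
      intro h
      apply hf0
      apply Subtype.ext
      apply lp.ext
      rw [h]; rfl
    have key := (re_tsum_weighted_form_neg hR h0 hLH hHL hHH hHB hR3' GH Ah AHB ABH E hGH hAh hAHB hABH hE
      hR1 (⇑(f : ℓ²(AbcClassI.Idx, ℂ))) hrapid hne).2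
    rw [inner_eq_tsum_conj_mul]
    convert key using 3 with i
    funext i
    rw [hG, hA_apply]
  -- the counting hypothesis
  have hK : ∀ x ∈ D, (∀ μ, ⟪e μ, x⟫_ℂ = 0) → 0 ≤ (⟪G x, x⟫_ℂ).re :=
    fun x _ hx => weight_form_nonneg_of_orthogonal GH V hR2 G hG e he x hx
  -- invariance and eigenvalues of `A` on `V = D`
  have hAV : ∀ (v : ℓ²(AbcClassI.Idx, ℂ)) (hv : v ∈ D), A ⟨v, hv⟩ ∈ D := by
    intro v hv
    obtain ⟨w, hw⟩ := hDmem v hv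
    have hvw : (⇑v : AbcClassI.Idx → ℂ) = (w : AbcClassI.Idx → ℂ) := by funext i; rw [← hw]; rfl
    have hmem : (fun i : AbcClassI.Idx => Lf v i - ((a : ℝ) : ℂ) * v i) ∈ W := by
      rw [hvw]
      have h2 : (fun i : AbcClassI.Idx => Lf (w : AbcClassI.Idx → ℂ) i - ((a : ℝ) : ℂ) * (w : AbcClassI.Idx → ℂ) i) =
          Lf w - ((a : ℝ) : ℂ) • (w : AbcClassI.Idx → ℂ) := by funext i; simp
      rw [h2]
      exact W.sub_mem (hWinv' w w.2) (W.smul_mem _ w.2)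
    refine LinearMap.mem_range.mpr ⟨⟨_, hmem⟩, ?_⟩
    apply lp.ext
    funext i
    rfl
  have hev : ∀ (μ : ℂ) (v : ℓ²(AbcClassI.Idx, ℂ)) (hv : v ∈ D), v ≠ 0 → A ⟨v, hv⟩ = μ • v → 0 ≤ μ.re := by
    intro μ v hv hv0 hAv
    obtain ⟨w, hw⟩ := hDmem v hv
    have hvw : (⇑v : AbcClassI.Idx → ℂ) = (w : AbcClassI.Idx → ℂ) := by funext i; rw [← hw]; rfl
    have hw0 : (w : AbcClassI.Idx → ℂ) ≠ 0 := by
      intro h; apply hv0; apply lp.ext; rw [hvw, h]; rfl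
    have heq : ∀ i : AbcClassI.Idx, Lf (w : AbcClassI.Idx → ℂ) i = (μ + a) * (w : AbcClassI.Idx → ℂ) i := by
      intro i
      have := congrArg (fun g : ℓ²(AbcClassI.Idx, ℂ) => g i) hAv
      simp only [lp.coeFn_smul, Pi.smul_apply, smul_eq_mul] at this
      change Lf v i - ((a : ℝ) : ℂ) * v i = μ * v i at this
      rw [hvw] at this
      linear_combination this
    have := hWev (μ + a) (w : AbcClassI.Idx → ℂ) w.2 hw0 heq
    simpa using this
  -- the format theorem
  have hcount := LyapunovInertiaCount.finrank_le_of_generator_form_neg hGsymm hL e hK D le_rfl hAV hev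
  rwa [hD, LinearMap.finrank_range_of_inj hι_inj] at hcount

end Count


/-! ### §4 The certificates' block weight `GH = X ⊕ 1`: the coupling matrix `F₂` -/

section Block

variable {R a rL rH : ℝ} (h0 : 0 ≤ rL) (hLH : rL + 1 ≤ rH)
variable {HL HH HB : Finset AbcClassI.Idx}
variable (hHL : ∀ i : AbcClassI.Idx, i ∈ HL ↔ onormSq i.1 ≤ rL ^ 2)
variable (hHH : ∀ i : AbcClassI.Idx, i ∈ HH ↔ onormSq i.1 ≤ rH ^ 2)
variable (hHB : ∀ i : AbcClassI.Idx, i ∈ HB ↔ rH ^ 2 < onormSq i.1 ∧ onormSq i.1 ≤ (rH + 1) ^ 2)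

include h0 hLH hHL hHH hHB in
/-- **`F₂` for a block weight.** If the head weight is `X` on `L × L` and the identity elsewhere on `H`
(`GH i j = δ_ij` unless both `i, j ∈ L`), then `(GH·amat_{HB} + amat_{BH}ᵀ) i l = 0` for `i ∈ L` and
`= AbcClassI.amat i l + AbcClassI.amat l i` for `i ∈ H ∖ L` ((R4): `AbcClassI.amat` vanishes across `L × B`). -/
theorem F2_apply_of_blockWeight (GH : Matrix ↥HH ↥HH ℝ) (AHB : Matrix ↥HH ↥HB ℝ) (ABH : Matrix ↥HB ↥HH ℝ)
    (hblock : ∀ i j : ↥HH, ¬ (i.1 ∈ HL ∧ j.1 ∈ HL) → GH i j = if i = j then 1 else 0)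
    (hAHB : AHB = Matrix.of fun (i : ↥HH) (l : ↥HB) => AbcClassI.amat i.1 l.1)
    (hABH : ABH = Matrix.of fun (l : ↥HB) (i : ↥HH) => AbcClassI.amat l.1 i.1) (i : ↥HH) (l : ↥HB) :
    (GH * AHB + ABHᵀ) i l = if i.1 ∈ HL then 0 else AbcClassI.amat i.1 l.1 + AbcClassI.amat l.1 i.1 := by
  classical
  rw [Matrix.add_apply, Matrix.mul_apply, Matrix.transpose_apply, hAHB, hABH]
  simp only [Matrix.of_apply]
  by_cases hi : i.1 ∈ HL
  · rw [if_pos hi]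
    have hsum : ∑ j : ↥HH, GH i j * AbcClassI.amat j.1 l.1 = 0 := by
      refine Finset.sum_eq_zero fun j _ => ?_
      by_cases hj : j.1 ∈ HL
      · rw [(amat_eq_zero_of_HL_HB h0 hLH hHL hHH hHB hj l.2).1, mul_zero]
      · have hij : i ≠ j := fun h => hj (h ▸ hi)
        rw [hblock i j (fun h => hj h.2), if_neg hij, zero_mul]
    rw [hsum, (amat_eq_zero_of_HL_HB h0 hLH hHL hHH hHB hi l.2).2, add_zero]
  · rw [if_neg hi]
    congr 1
    rw [Finset.sum_eq_single i]
    · rw [hblock i i (fun h => hi h.1), if_pos rfl, one_mul]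
    · intro j _ hji
      rw [hblock i j (fun h => hi h.1), if_neg (Ne.symm hji), zero_mul]
    · intro h; exact absurd (Finset.mem_univ i) h

end Block

end Summit.NavierStokesRegularity.FluidComputer.AbcInertiaCI

end
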